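import Mathlib
import HarnessLib
import Summits.NavierStokesRegularity.NavierStokesRegularity.Theorems.TaylorModelRungThreeSoundnessVectorDeriv

/-!
# Line `taylor-model` on crux K1b-DR (`ExactWindowRungThree.DerivativeEnclosureCertificateR`,
# stmt-NavierStokesRegularity-23954) — VECTOR STEP LEMMA, part 10: SCALING of the variational test (one
# certified direction box serves all directions of the κ-tube)

The variational equation `V' = Q(ψ,V) + Q(V,ψ)` is linear, so its rough-enclosure test (V1) and its solutions are
homogeneous in the start direction: a checker certifies ONE direction box (e.g. the unit `ω`-ball `[−ω, ω]`) with its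
variation box `[loV,hiV]`, and a segment `z' + σ(z − z')` of ω-length `dd` gets the derivative bound `dd·[loV,hiV]`
((F4)-shape: `|∂_σ φ| ≤ L1·dd·ω` once `max |loV| |hiV| ≤ L1·ω`, cf. `pub/pub-ns-dss/certificates/VECTOR-LEMMAS-23954.md`).

* `smul_mem_Icc_smul`, `roughEnclosureV_smul` — the (V1) test scales with `a ≥ 0`;
* `hasDerivWithinAt_flowSel_initial_smul` — `Fin n` corollary: for `v = a • v̂`, `v̂` in the certified start-direction
  box, `θ ↦ flowSel Q (x + θ • v) t` has derivative `V t` within `[0,1]`, `V` the variational solution from `v`,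
  confined to `[a•loV, a•hiV]`.

MODEL-lattice bookkeeping only (rung TL-M3 of the NS ladder: one finite-dimensional model ODE); nothing
here is a statement about the Navier–Stokes equations.
-/

noncomputable section

-- the sub-problem namespace repeats the summit name by design (D-0017)
set_option linter.dupNamespace false

namespace Summit.NavierStokesRegularity.NavierStokesRegularity.Theorems.TaylorModelVector

open scoped BigOperators Topology
open Set Filter

section General

variable {ι : Type*} [Fintype ι] [DecidableEq ι]
  (Q : (ι → ℝ) →ₗ[ℝ] (ι → ℝ) →ₗ[ℝ] ι → ℝ)

omit [Fintype ι] [DecidableEq ι] in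
/-- Scaling a box by `a ≥ 0`. [folklore] -/
theorem smul_mem_Icc_smul {lo hi y : ι → ℝ} (hy : y ∈ Icc lo hi) {a : ℝ} (ha : 0 ≤ a) :
    a • y ∈ Icc (a • lo) (a • hi) :=
  ⟨fun c => by simpa using mul_le_mul_of_nonneg_left (hy.1 c) ha,
   fun c => by simpa using mul_le_mul_of_nonneg_left (hy.2 c) ha⟩

omit [Fintype ι] [DecidableEq ι] in
/-- **The variational rough-enclosure test is homogeneous**: if `v₀ + u • (Q y v + Q v y) ∈ [loV,hiV]` for all
`y ∈ B`, `v ∈ [loV,hiV]`, `u ∈ [0,h]`, then the same holds for `a • v₀` and the box `[a•loV, a•hiV]` (`a ≥ 0`).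
[folklore] -/
theorem roughEnclosureV_smul {lo hi loV hiV v₀ : ι → ℝ} {h : ℝ}
    (hencV : ∀ y ∈ Icc lo hi, ∀ v ∈ Icc loV hiV, ∀ u ∈ Icc (0:ℝ) h,
      v₀ + u • (Q y v + Q v y) ∈ Icc loV hiV) {a : ℝ} (ha : 0 ≤ a) :
    ∀ y ∈ Icc lo hi, ∀ v ∈ Icc (a • loV) (a • hiV), ∀ u ∈ Icc (0:ℝ) h,
      a • v₀ + u • (Q y v + Q v y) ∈ Icc (a • loV) (a • hiV) := by
  intro y hy v hv u hu
  rcases eq_or_lt_of_le ha with h0 | hapos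
  · -- `a = 0`: the box is `{0}` and so is `v`
    subst h0
    have hv0 : v = 0 := by
      funext c
      have h1 := hv.1 c
      have h2 := hv.2 c
      simp only [Pi.smul_apply, smul_eq_mul, zero_mul, Pi.zero_apply] at h1 h2 ⊢
      linarith
    subst hv0
    simp
  · have hv' : a⁻¹ • v ∈ Icc loV hiV := by
      have h1 := smul_mem_Icc_smul hv (inv_nonneg.2 ha)
      rwa [smul_smul, smul_smul, inv_mul_cancel₀ hapos.ne', one_smul, one_smul] at h1
    have key := smul_mem_Icc_smul (hencV y hy _ hv' u hu) ha
    have e : a • (v₀ + u • (Q y (a⁻¹ • v) + Q (a⁻¹ • v) y)) = a • v₀ + u • (Q y v + Q v y) := by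
      rw [map_smul, map_smul, LinearMap.smul_apply, ← smul_add, smul_add, smul_smul, smul_smul,
        mul_comm a u, mul_assoc, mul_inv_cancel₀ hapos.ne', mul_one]
    rwa [e] at key

omit [DecidableEq ι] in
/-- **Variational solutions scale**: if `V` solves the variational equation along `ψ` then so does `a • V`.
[folklore] -/
theorem variational_smul {ψ V : ℝ → ι → ℝ} {S : Set ℝ}
    (hV : ∀ s ∈ S, HasDerivWithinAt V (Q (ψ s) (V s) + Q (V s) (ψ s)) S s) (a : ℝ) :
    ∀ s ∈ S, HasDerivWithinAt (fun σ => a • V σ) (Q (ψ s) (a • V s) + Q (a • V s) (ψ s)) S s := by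
  intro s hs
  refine ((hV s hs).const_smul a).congr_deriv ?_
  rw [map_smul, map_smul, LinearMap.smul_apply, smul_add]

end General

/-! ### `Fin n` corollary: segment derivative for a scaled direction -/

section Majorant

open Summit.NavierStokesRegularity.NavierStokesRegularity.Theorems.TaylorModelMajorant

variable {n : ℕ} {Q : (Fin n → ℝ) → (Fin n → ℝ) → Fin n → ℝ} {w : Fin n → ℝ} {b : ℝ}
  {T : (Fin n → ℝ) → ℕ → Fin n → ℝ} {U : (Fin n → ℝ) → (Fin n → ℝ) → ℕ → Fin n → ℝ}

/-- **Segment derivative of the selector for a SCALED direction** ((F4)-shape with the ω-length `a = dd` of the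
segment): the start states `x + θ • v` (`θ ∈ [0,1]`, `v = a • v̂`) pass the first-order test for `[lo,hi]`; ONE start
direction box `[loV₀,hiV₀] ∋ v̂` passes the variational test for `[loV,hiV]`; then for `θ₀ ∈ [0,1]`, `t ∈ [0,h]`
there is a variational solution `V` from `v` along `flowSel Q (x + θ₀ • v)`, confined to `[a•loV, a•hiV]`, with
`HasDerivWithinAt (fun θ => flowSel Q (x + θ • v) t) (V t) (Icc 0 1) θ₀`. [folklore] -/
theorem hasDerivWithinAt_flowSel_initial_smul (hS : IsMajorantSystem n Q w b T U)
    {lo hi loV hiV loV₀ hiV₀ x v vhat : Fin n → ℝ} {h a : ℝ} (hh : 0 ≤ h) (ha : 0 ≤ a) (hv : v = a • vhat)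
    (hseg : ∀ θ ∈ Icc (0:ℝ) 1, x + θ • v ∈ Icc lo hi) (hvhat : vhat ∈ Icc loV₀ hiV₀)
    (hV₀ : Icc loV₀ hiV₀ ⊆ Icc loV hiV)
    (henc : ∀ θ ∈ Icc (0:ℝ) 1, ∀ y ∈ Icc lo hi, ∀ u ∈ Icc (0:ℝ) h, (x + θ • v) + u • Q y y ∈ Icc lo hi)
    (hencV : ∀ v₀ ∈ Icc loV₀ hiV₀, ∀ y ∈ Icc lo hi, ∀ d ∈ Icc loV hiV, ∀ u ∈ Icc (0:ℝ) h,
      v₀ + u • (Q y d + Q d y) ∈ Icc loV hiV)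
    {θ₀ : ℝ} (hθ₀ : θ₀ ∈ Icc (0:ℝ) 1) {t : ℝ} (ht : t ∈ Icc 0 h) :
    ∃ V : ℝ → Fin n → ℝ, V 0 = v ∧
      (∀ s ∈ Icc 0 h, HasDerivWithinAt V
        (Q (flowSel Q (x + θ₀ • v) s) (V s) + Q (V s) (flowSel Q (x + θ₀ • v) s)) (Icc 0 h) s) ∧
      (∀ s ∈ Icc 0 h, V s ∈ Icc (a • loV) (a • hiV)) ∧
      HasDerivWithinAt (fun θ => flowSel Q (x + θ • v) t) (V t) (Icc 0 1) θ₀ := by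
  obtain ⟨Qb, hQb⟩ := exists_bundle hS
  have hencV' : ∀ y ∈ Icc lo hi, ∀ d ∈ Icc loV hiV, ∀ u ∈ Icc (0:ℝ) h,
      vhat + u • (Qb y d + Qb d y) ∈ Icc loV hiV := by
    simpa only [hQb] using hencV vhat hvhat
  have hencVa := roughEnclosureV_smul Qb hencV' ha
  rw [← hv] at hencVa
  have hencVa' : ∀ y ∈ Icc lo hi, ∀ d ∈ Icc (a • loV) (a • hiV), ∀ u ∈ Icc (0:ℝ) h,
      v + u • (Q y d + Q d y) ∈ Icc (a • loV) (a • hiV) := by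
    simpa only [hQb] using hencVa
  have hva : v ∈ Icc (a • loV) (a • hiV) := hv ▸ smul_mem_Icc_smul (hV₀ hvhat) ha
  exact hasDerivWithinAt_flowSel_initial hS hh hseg hva henc hencVa' hθ₀ ht

end Majorant

end Summit.NavierStokesRegularity.NavierStokesRegularity.Theorems.TaylorModelVector

end
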